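import Mathlib
import Literature.NumberTheory.LFunctions.Zhang2022.Section10cMid1214Int
import Literature.NumberTheory.LFunctions.Zhang2022.TypedSection10B
import HarnessLib

/-!
# Zhang (2022) §10b: the profiles of the three "second lines" of the evaluation of `Θ₁(𝐚₁₁,𝐚₁₃)`
# (tools for DAG nodes Z22:§10.u036 (ii), u037 (ii), u038 (ii))

Topic `Literature/NumberTheory/LFunctions/Zhang2022` (Landau–Siegel audit tree; verdict-neutral).
Y. Zhang, *Discrete mean estimates and the Landau–Siegel zero*, arXiv:2211.02515v1 (2022)
[Zhang2022LandauSiegel], §10 p. 57 (the three displays of the evaluation of `Θ₁(𝐚₁₁,𝐚₁₃)` before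
(10.12)) — **an unrefereed manuscript under adjudication; this file asserts nothing about its
Theorems 1–2 or about Landau–Siegel zeros.** ZHANG-L discharge lane (WP10, seat zl-w10-p3), leaf
`Typed.Sec10B.Concl1113` of `Skeleton.theorem1_of_leaves_v19`; theorem-only TOOL file (no new
definitions, no facts), consumed by `Section10Range1113SecondLines`.

What is PROVED here (kernel-checked):

* `nAvg_zero_eq_lamAvg_one` — the §10b collapsed sum over `n < P^{0.5}` (`Typed.Sec10B.nAvg` with
  `lo = 0`) IS the §10c sum `Typed.Sec10C.lamAvg(1, P^{0.5}, ·)`; selector bridges `ffSel_six`,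
  `yy1Sel_apply`, `yy2Sel_apply`, `yy1Sel_eq_yyJ1`, `yy2Sel_eq_yyJ2`; `frakfW6_at_rpow504`
  (`𝔣_{j6}(P^{0.504}/P^z) = 𝔣(β_j, β₆; (0.504 − z)log P)`);
* `y1ProfileU_bounds`, `y2ProfileU_bounds` — the UNSHIFTED profiles `−1 + 𝔶₁ⱼ(t)`, `1 + 𝔶₂ⱼ(t)` of
  (10.9), (10.10) are `C¹` on `[1, P]` with `‖·‖ ≤ 417`, resp. `161`, and `‖d/dt‖ ≤ 200α/t`, resp.
  `72α/t` (the shifted twins `𝔶_{1,2;j}(P^{0.004}t)` are sz-d39's `Typed.Sec10C.y1Profile_bounds`,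
  `y2Profile_bounds`);
* `mid1113Profile_bounds`, `top1113Profile_bounds`, `low1113Profile_bounds` — the three profiles
  `𝔣_{j6}(P^{0.504}/t)(−1 + 𝔶₁ⱼ(t))`, `𝔣_{j6}(P^{0.504}/t)(1 + 𝔶₂ⱼ(t))`,
  `𝔣_{j6}(P^{0.504}/t)/0.504 + ι₂𝔣_{j7}(P^{0.5}/t)/0.5` with explicit `O(1)`, `O(α/t)` bounds;
* `basic_facts_of_ell_six` — the standing largeness facts at `𝓛 ≥ 6`, `5|c′|α𝓛 ≤ 1`.

## References

* Y. Zhang, arXiv:2211.02515v1 (2022), §10 p. 57, (10.9), (10.10); §8 Lemma 8.2; §2 (2.13).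
  [cite: Zhang2022LandauSiegel, §10 p. 57]
-/

noncomputable section

open Complex Real ComplexConjugate MeasureTheory
open Literature.NumberTheory.LFunctions.Zhang2022.Skeleton

namespace Literature.NumberTheory.LFunctions.Zhang2022.Typed.Sec10B

section Profiles1113

/-! ### Bridges between the §10b and §10c vocabularies -/

/-- The §10b collapsed sum over `n < P^{0.5}` (`lo = 0`, `n ≥ 1`) IS `lamAvg(1, P^{0.5}, g)`.
[cite: Zhang2022LandauSiegel, §10 p. 57] -/
theorem nAvg_zero_eq_lamAvg_one (c' : ℝ) {D : ℕ} [NeZero D] (χ : DirichletCharacter ℂ D) (j : ℕ)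
    (hi : ℝ) (g : ℕ → ℂ) : nAvg c' χ j 0 hi g = Sec10C.lamAvg c' χ j 1 hi g := by
  unfold nAvg Sec10C.lamAvg
  rw [Nat.ceil_one]
  refine Finset.sum_congr ?_ fun _ _ => rfl
  ext n
  simp only [Finset.mem_filter, Finset.mem_Ico, Nat.cast_nonneg, and_true]

/-- `𝔣𝔣_{j6}` in the two selector spellings (`Sec10B.ffSel j 6` vs `Sec10C.ffJ6 j`).
[cite: Zhang2022LandauSiegel, §8 (8.13)–(8.15)] -/
theorem ffSel_six (j : ℕ) : ffSel j 6 = Sec10C.ffJ6 j := by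
  unfold ffSel Sec10C.ffJ6 Sec10C.byJ
  simp

/-- `𝔶𝔶₁ⱼ` applied. [cite: Zhang2022LandauSiegel, §10 p. 56] -/
theorem yy1Sel_apply (j : ℕ) (w : ℝ) :
    yy1Sel j w = if j = 1 then yy11 w else if j = 2 then yy12 w else yy13 w := by
  unfold yy1Sel
  split_ifs <;> rfl

/-- `𝔶𝔶₂ⱼ` applied. [cite: Zhang2022LandauSiegel, §10 p. 56] -/
theorem yy2Sel_apply (j : ℕ) (w : ℝ) :
    yy2Sel j w = if j = 1 then yy21 w else if j = 2 then yy22 w else yy23 w := by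
  unfold yy2Sel
  split_ifs <;> rfl

/-- `𝔶𝔶₁ⱼ` in the two selector spellings. [cite: Zhang2022LandauSiegel, §10 p. 56] -/
theorem yy1Sel_eq_yyJ1 (j : ℕ) : yy1Sel j = Sec10C.yyJ1 j := by
  unfold yy1Sel Sec10C.yyJ1 Sec10C.byJ
  rfl

/-- `𝔶𝔶₂ⱼ` in the two selector spellings. [cite: Zhang2022LandauSiegel, §10 p. 56] -/
theorem yy2Sel_eq_yyJ2 (j : ℕ) : yy2Sel j = Sec10C.yyJ2 j := by
  unfold yy2Sel Sec10C.yyJ2 Sec10C.byJ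
  rfl

/-- `𝔣_{j6}(P^{0.504}/P^z) = 𝔣(β_j, β₆; (0.504 − z)·log P)`. [cite: Zhang2022LandauSiegel, §8 Lemma 8.2] -/
theorem frakfW6_at_rpow504 (c' : ℝ) (D j : ℕ) (z : ℝ) :
    frakfW c' D j 6 (bigP D ^ (0.504 : ℝ) / bigP D ^ z) =
      frakf (betaJ c' D j) (beta6 D) ((Real.log (bigP D) : ℂ) * (((0.504 - z : ℝ)) : ℂ)) := by
  have hP : 0 < bigP D := Real.exp_pos _
  have h6 : betaMu D 6 = beta6 D := by norm_num [betaMu]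
  rw [frakfW, h6, ← Real.rpow_sub hP, Real.log_rpow hP]
  congr 1
  rw [Complex.ofReal_mul, mul_comm]

/-- `y/P^{0.5} = (P^{0.5}/y)⁻¹` (to read `log(y/P^{0.5}) = −log(P^{0.5}/y)` in (10.9)).
[cite: Zhang2022LandauSiegel, §10 (10.9)] -/
theorem div_sqrtP_eq_inv (D : ℕ) (u : ℝ) :
    u / bigP D ^ (0.5 : ℝ) = (bigP D ^ (0.5 : ℝ) / u)⁻¹ := (inv_div _ _).symm

/-! ### The profiles `−1 + 𝔶₁ⱼ(t)` and `1 + 𝔶₂ⱼ(t)` (unshifted) -/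

/-- **`t ↦ −1 + 𝔶₁ⱼ(t)` on `[1, P]`** (`𝔶₁ⱼ` of (10.9) `= −(β_{j+1}+β_{j+2})L₁ + ½β_{j+1}β_{j+2}(L₂² − 2L₃²)`,
`L₁ = log(P^{0.5}/t)`, `L₂ = log(P^{0.504}/t)`, `L₃ = log(P^{0.502}/t)`): differentiable, `‖·‖ ≤ 417`,
`‖d/dt‖ ≤ 200α/t` (given `5|c′|α𝓛 ≤ 1`, `α log P ≤ 4`). [cite: Zhang2022LandauSiegel, §10 (10.9)] -/
theorem y1ProfileU_bounds (c' : ℝ) {D : ℕ} (j : ℕ) {t : ℝ} (hα : 0 < alpha D) (hℓ : 0 ≤ ell D)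
    (hc : 5 * |c'| * alpha D * ell D ≤ 1) (ht1 : 1 ≤ t) (htP : t ≤ bigP D)
    (hΛ4 : alpha D * Real.log (bigP D) ≤ 4) :
    DifferentiableAt ℝ (fun u : ℝ => -1 + fraky1 c' D j u) t ∧
      ‖-1 + fraky1 c' D j t‖ ≤ 417 ∧
      ‖deriv (fun u : ℝ => -1 + fraky1 c' D j u) t‖ ≤ 200 * alpha D / t := by
  have ht : 0 < t := by linarith
  have hP1 : 1 ≤ bigP D := by linarith
  obtain ⟨hQ1a, hQ1b⟩ := Sec10C.rpow_window hP1 (e := 0.5) (by norm_num) (by norm_num)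
  obtain ⟨hQ2a, hQ2b⟩ := Sec10C.rpow_window hP1 (e := 0.504) (by norm_num) (by norm_num)
  obtain ⟨hQ3a, hQ3b⟩ := Sec10C.rpow_window hP1 (e := 0.502) (by norm_num) (by norm_num)
  set Q₁ : ℝ := bigP D ^ (0.5 : ℝ) with hQ₁
  set Q₂ : ℝ := bigP D ^ (0.504 : ℝ) with hQ₂
  set Q₃ : ℝ := bigP D ^ (0.502 : ℝ) with hQ₃
  set S : ℂ := betaJ c' D (j + 1) + betaJ c' D (j + 2) with hS
  set Pr : ℂ := betaJ c' D (j + 1) * betaJ c' D (j + 2) with hPr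
  set L : ℝ → ℝ → ℂ := fun Q u => ((Real.log (Q / u) : ℝ) : ℂ) with hL
  have hfun : (fun u : ℝ => -1 + fraky1 c' D j u) =
      fun u => -1 + S * -L Q₁ u + Pr / 2 * (L Q₂ u * L Q₂ u - 2 * (L Q₃ u * L Q₃ u)) := by
    funext u
    simp only [hL, fraky1, div_sqrtP_eq_inv, Real.log_inv, hS, hPr, hQ₁, hQ₂, hQ₃]
    push_cast
    ring
  have hLd : ∀ Q : ℝ, 0 < Q → HasDerivAt (fun u => L Q u) (-((t : ℂ)⁻¹)) t := fun Q hQ0 =>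
    Section8AbelProfiles.hasDerivAt_ofReal_log_div hQ0 ht
  have hd1 := hLd Q₁ (by linarith); have hd2 := hLd Q₂ (by linarith); have hd3 := hLd Q₃ (by linarith)
  have hd : HasDerivAt (fun u => -1 + S * -L Q₁ u + Pr / 2 * (L Q₂ u * L Q₂ u - 2 * (L Q₃ u * L Q₃ u)))
      ((S - Pr * L Q₂ t + 2 * Pr * L Q₃ t) * (t : ℂ)⁻¹) t := by
    have h := ((hd1.neg.const_mul S).const_add (-1)).add
      (((hd2.mul hd2).sub ((hd3.mul hd3).const_mul 2)).const_mul (Pr / 2))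
    refine (h.congr_of_eventuallyEq (Filter.Eventually.of_forall fun x => ?_)).congr_deriv (by ring)
    simp only [Pi.add_apply, Pi.neg_apply, Pi.mul_apply, Pi.sub_apply]
  -- sizes
  have hLb : ∀ Q : ℝ, 1 ≤ Q → Q ≤ bigP D → alpha D * ‖L Q t‖ ≤ 4 := by
    intro Q h1 h2
    have : ‖L Q t‖ = |Real.log (Q / t)| := by rw [hL]; simp only [Complex.norm_real, Real.norm_eq_abs]
    rw [this]
    exact (mul_le_mul_of_nonneg_left (Section8AbelProfiles.abs_log_div_le h1 h2 ht1 htP) hα.le).trans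
      hΛ4
  have hb1 := hLb Q₁ hQ1a hQ1b
  have hb2 := hLb Q₂ hQ2a hQ2b
  have hb3 := hLb Q₃ hQ3a hQ3b
  have hβ1 := Section8AbelProfiles.norm_betaJ_le c' hα.le hℓ hc (j + 1)
  have hβ2 := Section8AbelProfiles.norm_betaJ_le c' hα.le hℓ hc (j + 2)
  have hSn : ‖S‖ ≤ 8 * alpha D := (norm_add_le _ _).trans (by linarith)
  have hPrn : ‖Pr‖ ≤ (4 * alpha D) * (4 * alpha D) := by
    rw [hPr, norm_mul]; exact mul_le_mul hβ1 hβ2 (norm_nonneg _) (by positivity)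
  have n1 := norm_nonneg (L Q₁ t); have n2 := norm_nonneg (L Q₂ t); have n3 := norm_nonneg (L Q₃ t)
  have hb2sq : (alpha D * ‖L Q₂ t‖) ^ 2 ≤ 4 ^ 2 := pow_le_pow_left₀ (by positivity) hb2 2
  have hb3sq : (alpha D * ‖L Q₃ t‖) ^ 2 ≤ 4 ^ 2 := pow_le_pow_left₀ (by positivity) hb3 2
  have hval : ‖-1 + S * -L Q₁ t + Pr / 2 * (L Q₂ t * L Q₂ t - 2 * (L Q₃ t * L Q₃ t))‖ ≤ 417 := by
    have e1 : ‖S * -L Q₁ t‖ ≤ 8 * (alpha D * ‖L Q₁ t‖) := by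
      rw [norm_mul, norm_neg]; nlinarith
    have e2 : ‖Pr / 2 * (L Q₂ t * L Q₂ t - 2 * (L Q₃ t * L Q₃ t))‖ ≤
        8 * ((alpha D * ‖L Q₂ t‖) ^ 2 + 2 * (alpha D * ‖L Q₃ t‖) ^ 2) := by
      have : ‖L Q₂ t * L Q₂ t - 2 * (L Q₃ t * L Q₃ t)‖ ≤ ‖L Q₂ t‖ ^ 2 + 2 * ‖L Q₃ t‖ ^ 2 := by
        refine (norm_sub_le _ _).trans ?_
        rw [norm_mul, norm_mul, norm_mul, Complex.norm_two]; nlinarith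
      rw [norm_mul, norm_div, Complex.norm_two]
      calc ‖Pr‖ / 2 * ‖L Q₂ t * L Q₂ t - 2 * (L Q₃ t * L Q₃ t)‖
          ≤ (4 * alpha D) * (4 * alpha D) / 2 * (‖L Q₂ t‖ ^ 2 + 2 * ‖L Q₃ t‖ ^ 2) := by gcongr
        _ = 8 * ((alpha D * ‖L Q₂ t‖) ^ 2 + 2 * (alpha D * ‖L Q₃ t‖) ^ 2) := by ring
    calc _ ≤ ‖(-1 : ℂ)‖ + ‖S * -L Q₁ t‖ + ‖Pr / 2 * (L Q₂ t * L Q₂ t - 2 * (L Q₃ t * L Q₃ t))‖ :=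
          norm_add₃_le
      _ ≤ 1 + 8 * 4 + 8 * (4 ^ 2 + 2 * 4 ^ 2) := by
          rw [norm_neg, norm_one]
          gcongr
          · exact e1.trans (by linarith)
          · exact e2.trans (by linarith)
      _ = 417 := by norm_num
  have hder : ‖S - Pr * L Q₂ t + 2 * Pr * L Q₃ t‖ ≤ 200 * alpha D := by
    calc _ ≤ ‖S - Pr * L Q₂ t‖ + ‖2 * Pr * L Q₃ t‖ := norm_add_le _ _
      _ ≤ ‖S‖ + ‖Pr * L Q₂ t‖ + ‖2 * Pr * L Q₃ t‖ := by gcongr; exact norm_sub_le _ _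
      _ = ‖S‖ + ‖Pr‖ * ‖L Q₂ t‖ + 2 * ‖Pr‖ * ‖L Q₃ t‖ := by
          rw [norm_mul Pr (L Q₂ t), norm_mul (2 * Pr) (L Q₃ t), norm_mul (2 : ℂ) Pr,
            Complex.norm_two]
      _ ≤ 8 * alpha D + (4 * alpha D) * (4 * alpha D) * ‖L Q₂ t‖ +
            2 * ((4 * alpha D) * (4 * alpha D)) * ‖L Q₃ t‖ := by gcongr
      _ = 8 * alpha D + 16 * alpha D * (alpha D * ‖L Q₂ t‖) +
            32 * alpha D * (alpha D * ‖L Q₃ t‖) := by ring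
      _ ≤ 8 * alpha D + 16 * alpha D * 4 + 32 * alpha D * 4 := by gcongr
      _ = 200 * alpha D := by ring
  refine ⟨by rw [hfun]; exact hd.differentiableAt, ?_, ?_⟩
  · show ‖(fun u : ℝ => -1 + fraky1 c' D j u) t‖ ≤ 417
    rw [hfun]; exact hval
  · rw [hfun, hd.deriv, norm_mul, norm_inv, Complex.norm_real, Real.norm_eq_abs, abs_of_pos ht,
      ← div_eq_mul_inv]
    exact div_le_div_of_nonneg_right hder ht.le

/-- **`t ↦ 1 + 𝔶₂ⱼ(t)` on `[1, P]`** (`𝔶₂ⱼ` of (10.10) is `(β_{j+1}+β_{j+2})L + ½β_{j+1}β_{j+2}L²` in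
`L = log(P^{0.504}/t)`): differentiable, `‖1 + 𝔶₂ⱼ(t)‖ ≤ 161`, `‖(d/dt)(1 + 𝔶₂ⱼ(t))‖ ≤ 72α/t`,
provided `5|c′|α𝓛 ≤ 1` and `α log P ≤ 4`. [cite: Zhang2022LandauSiegel, §10 (10.10)] -/
theorem y2ProfileU_bounds (c' : ℝ) {D : ℕ} (j : ℕ) {t : ℝ} (hα : 0 < alpha D) (hℓ : 0 ≤ ell D)
    (hc : 5 * |c'| * alpha D * ell D ≤ 1) (ht1 : 1 ≤ t) (htP : t ≤ bigP D)
    (hΛ4 : alpha D * Real.log (bigP D) ≤ 4) :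
    DifferentiableAt ℝ (fun u : ℝ => 1 + fraky2 c' D j u) t ∧
      ‖1 + fraky2 c' D j t‖ ≤ 161 ∧
      ‖deriv (fun u : ℝ => 1 + fraky2 c' D j u) t‖ ≤ 72 * alpha D / t := by
  have ht : 0 < t := by linarith
  have hP1 : 1 ≤ bigP D := by linarith
  obtain ⟨hQ1, hQP⟩ := Sec10C.rpow_window hP1 (e := 0.504) (by norm_num) (by norm_num)
  set Q : ℝ := bigP D ^ (0.504 : ℝ) with hQ
  have hQ0 : 0 < Q := by linarith
  set S : ℂ := betaJ c' D (j + 1) + betaJ c' D (j + 2) with hS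
  set Pr : ℂ := betaJ c' D (j + 1) * betaJ c' D (j + 2) with hPr
  set g : ℂ → ℂ := fun L => 1 + S * L + Pr / 2 * L ^ 2 with hg
  have hfun : (fun u : ℝ => 1 + fraky2 c' D j u) = fun u => g ((Real.log (Q / u) : ℝ) : ℂ) := by
    funext u
    simp only [hg, fraky2, hS, hPr, hQ]
    ring
  have hg' : ∀ L : ℂ, HasDerivAt g (S + Pr * L) L := by
    intro L
    have h1 : HasDerivAt (fun L : ℂ => S * L) S L := by
      simpa using (hasDerivAt_id L).const_mul S
    have h2 : HasDerivAt (fun L : ℂ => L ^ 2) (2 * L) L := by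
      simpa using hasDerivAt_pow 2 L
    have h3 := (h1.add (h2.const_mul (Pr / 2))).const_add 1
    refine (h3.congr_of_eventuallyEq (Filter.Eventually.of_forall fun x => ?_)).congr_deriv (by ring)
    simp only [hg, Pi.add_apply]
    ring
  have hd : HasDerivAt (fun u : ℝ => g ((Real.log (Q / u) : ℝ) : ℂ))
      (-((S + Pr * ((Real.log (Q / t) : ℝ) : ℂ))) * (t : ℂ)⁻¹) t :=
    Section8AbelProfiles.hasDerivAt_comp_log_div hg' hQ0 ht
  -- sizes
  have hL : |Real.log (Q / t)| ≤ Real.log (bigP D) :=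
    Section8AbelProfiles.abs_log_div_le hQ1 hQP ht1 htP
  have hαL : alpha D * |Real.log (Q / t)| ≤ 4 := (mul_le_mul_of_nonneg_left hL hα.le).trans hΛ4
  have hβ1 := Section8AbelProfiles.norm_betaJ_le c' hα.le hℓ hc (j + 1)
  have hβ2 := Section8AbelProfiles.norm_betaJ_le c' hα.le hℓ hc (j + 2)
  have hSn : ‖S‖ ≤ 8 * alpha D := (norm_add_le _ _).trans (by linarith)
  have hPrn : ‖Pr‖ ≤ (4 * alpha D) * (4 * alpha D) := by
    rw [hPr, norm_mul]; exact mul_le_mul hβ1 hβ2 (norm_nonneg _) (by positivity)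
  have hLn : ‖((Real.log (Q / t) : ℝ) : ℂ)‖ = |Real.log (Q / t)| := by
    rw [Complex.norm_real, Real.norm_eq_abs]
  set ℓt : ℝ := |Real.log (Q / t)| with hℓt
  have hℓt0 : 0 ≤ ℓt := abs_nonneg _
  have hgval : ‖g ((Real.log (Q / t) : ℝ) : ℂ)‖ ≤ 161 := by
    simp only [hg]
    calc ‖1 + S * ((Real.log (Q / t) : ℝ) : ℂ) + Pr / 2 * ((Real.log (Q / t) : ℝ) : ℂ) ^ 2‖
        ≤ ‖(1 : ℂ)‖ + ‖S * ((Real.log (Q / t) : ℝ) : ℂ)‖ +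
            ‖Pr / 2 * ((Real.log (Q / t) : ℝ) : ℂ) ^ 2‖ := norm_add₃_le
      _ = 1 + ‖S‖ * ℓt + ‖Pr‖ / 2 * ℓt ^ 2 := by
          rw [norm_one, norm_mul, norm_mul, norm_div, norm_pow, hLn, hℓt]
          norm_num
      _ ≤ 1 + 8 * alpha D * ℓt + (4 * alpha D) * (4 * alpha D) / 2 * ℓt ^ 2 := by gcongr
      _ = 1 + 8 * (alpha D * ℓt) + 8 * (alpha D * ℓt) ^ 2 := by ring
      _ ≤ 1 + 8 * 4 + 8 * 4 ^ 2 := by gcongr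
      _ = 161 := by norm_num
  have hg'val : ‖S + Pr * ((Real.log (Q / t) : ℝ) : ℂ)‖ ≤ 72 * alpha D := by
    calc ‖S + Pr * ((Real.log (Q / t) : ℝ) : ℂ)‖ ≤ ‖S‖ + ‖Pr‖ * ℓt := by
          refine (norm_add_le _ _).trans ?_; rw [norm_mul, hLn]
      _ ≤ 8 * alpha D + (4 * alpha D) * (4 * alpha D) * ℓt := by gcongr
      _ = 8 * alpha D + 16 * alpha D * (alpha D * ℓt) := by ring
      _ ≤ 8 * alpha D + 16 * alpha D * 4 := by gcongr
      _ = 72 * alpha D := by ring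
  refine ⟨by rw [hfun]; exact hd.differentiableAt, ?_, ?_⟩
  · show ‖(fun u : ℝ => 1 + fraky2 c' D j u) t‖ ≤ 161
    rw [hfun]; exact hgval
  · rw [hfun, hd.deriv, norm_mul, norm_neg, norm_inv, Complex.norm_real, Real.norm_eq_abs,
      abs_of_pos ht, ← div_eq_mul_inv]
    exact div_le_div_of_nonneg_right hg'val ht.le

/-- **The middle-range profile `t ↦ 𝔣_{j6}(P^{0.504}/t)(−1 + 𝔶₁ⱼ(t))` on `[1, P]`**: differentiable,
`‖·‖ ≤ 12093 = 29·417`, `‖d/dt‖ ≤ 44998α/t`. [cite: Zhang2022LandauSiegel, §10 p. 57] -/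
theorem mid1113Profile_bounds (c' : ℝ) {D : ℕ} (j : ℕ) {t : ℝ} (hα : 0 < alpha D) (hℓ : 0 ≤ ell D)
    (hc : 5 * |c'| * alpha D * ell D ≤ 1) (ht1 : 1 ≤ t) (htP : t ≤ bigP D)
    (hΛ4 : alpha D * Real.log (bigP D) ≤ 4) :
    DifferentiableAt ℝ (fun u : ℝ => frakfW c' D j 6 (bigP D ^ (0.504 : ℝ) / u) *
        (-1 + fraky1 c' D j u)) t ∧
      ‖frakfW c' D j 6 (bigP D ^ (0.504 : ℝ) / t) * (-1 + fraky1 c' D j t)‖ ≤ 12093 ∧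
      ‖deriv (fun u : ℝ => frakfW c' D j 6 (bigP D ^ (0.504 : ℝ) / u) *
          (-1 + fraky1 c' D j u)) t‖ ≤ 44998 * alpha D / t := by
  have hP1 : 1 ≤ bigP D := by linarith
  obtain ⟨hQ1, hQP⟩ := Sec10C.rpow_window hP1 (e := 0.504) (by norm_num) (by norm_num)
  obtain ⟨hfd, hfn, hfd'⟩ := Section8AbelProfiles.frakfW_div_bounds c' j 6 hα hℓ hc hQ1 hQP ht1 htP
    hΛ4
  obtain ⟨hgd, hgn, hgd'⟩ := y1ProfileU_bounds c' j hα hℓ hc ht1 htP hΛ4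
  obtain ⟨h1, h2, h3⟩ := Section8AbelProfiles.mul_bounds hfd hgd hfn hgn hfd' hgd' (by norm_num)
  refine ⟨h1, h2.trans (by norm_num), h3.trans (le_of_eq ?_)⟩
  ring

/-- **The top-range profile `t ↦ 𝔣_{j6}(P^{0.504}/t)(1 + 𝔶₂ⱼ(t))` on `[1, P]`**: differentiable,
`‖·‖ ≤ 4669 = 29·161`, `‖d/dt‖ ≤ 17222α/t`. [cite: Zhang2022LandauSiegel, §10 p. 57] -/
theorem top1113Profile_bounds (c' : ℝ) {D : ℕ} (j : ℕ) {t : ℝ} (hα : 0 < alpha D) (hℓ : 0 ≤ ell D)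
    (hc : 5 * |c'| * alpha D * ell D ≤ 1) (ht1 : 1 ≤ t) (htP : t ≤ bigP D)
    (hΛ4 : alpha D * Real.log (bigP D) ≤ 4) :
    DifferentiableAt ℝ (fun u : ℝ => frakfW c' D j 6 (bigP D ^ (0.504 : ℝ) / u) *
        (1 + fraky2 c' D j u)) t ∧
      ‖frakfW c' D j 6 (bigP D ^ (0.504 : ℝ) / t) * (1 + fraky2 c' D j t)‖ ≤ 4669 ∧
      ‖deriv (fun u : ℝ => frakfW c' D j 6 (bigP D ^ (0.504 : ℝ) / u) *
          (1 + fraky2 c' D j u)) t‖ ≤ 17222 * alpha D / t := by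
  have hP1 : 1 ≤ bigP D := by linarith
  obtain ⟨hQ1, hQP⟩ := Sec10C.rpow_window hP1 (e := 0.504) (by norm_num) (by norm_num)
  obtain ⟨hfd, hfn, hfd'⟩ := Section8AbelProfiles.frakfW_div_bounds c' j 6 hα hℓ hc hQ1 hQP ht1 htP
    hΛ4
  obtain ⟨hgd, hgn, hgd'⟩ := y2ProfileU_bounds c' j hα hℓ hc ht1 htP hΛ4
  obtain ⟨h1, h2, h3⟩ := Section8AbelProfiles.mul_bounds hfd hgd hfn hgn hfd' hgd' (by norm_num)
  refine ⟨h1, h2.trans (by norm_num), h3.trans (le_of_eq ?_)⟩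
  ring

/-- **The low-range `m`-side profile `t ↦ 𝔣_{j6}(P^{0.504}/t)/0.504 + ι₂𝔣_{j7}(P^{0.5}/t)/0.5` on
`[1, P]`**: differentiable, `‖·‖ ≤ 58(1 + ‖ι₂‖)`, `‖d/dt‖ ≤ 188(1 + ‖ι₂‖)α/t`.
[cite: Zhang2022LandauSiegel, §10 p. 57] -/
theorem low1113Profile_bounds (c' : ℝ) {D : ℕ} (j : ℕ) {t : ℝ} (hα : 0 < alpha D) (hℓ : 0 ≤ ell D)
    (hc : 5 * |c'| * alpha D * ell D ≤ 1) (ht1 : 1 ≤ t) (htP : t ≤ bigP D)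
    (hΛ4 : alpha D * Real.log (bigP D) ≤ 4) :
    DifferentiableAt ℝ (fun u : ℝ => frakfW c' D j 6 (bigP D ^ (0.504 : ℝ) / u) / 0.504 +
        iota2 * frakfW c' D j 7 (bigP D ^ (0.5 : ℝ) / u) / 0.5) t ∧
      ‖frakfW c' D j 6 (bigP D ^ (0.504 : ℝ) / t) / 0.504 +
          iota2 * frakfW c' D j 7 (bigP D ^ (0.5 : ℝ) / t) / 0.5‖ ≤ 58 * (1 + ‖iota2‖) ∧
      ‖deriv (fun u : ℝ => frakfW c' D j 6 (bigP D ^ (0.504 : ℝ) / u) / 0.504 +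
          iota2 * frakfW c' D j 7 (bigP D ^ (0.5 : ℝ) / u) / 0.5) t‖ ≤
        188 * (1 + ‖iota2‖) * alpha D / t := by
  have ht : 0 < t := by linarith
  have hP1 : 1 ≤ bigP D := by linarith
  obtain ⟨hQ4a, hQ4b⟩ := Sec10C.rpow_window hP1 (e := 0.504) (by norm_num) (by norm_num)
  obtain ⟨hQ2a, hQ2b⟩ := Sec10C.rpow_window hP1 (e := 0.5) (by norm_num) (by norm_num)
  obtain ⟨h6d, h6n, h6d'⟩ := Section8AbelProfiles.frakfW_div_bounds c' j 6 hα hℓ hc hQ4a hQ4b ht1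
    htP hΛ4
  obtain ⟨h7d, h7n, h7d'⟩ := Section8AbelProfiles.frakfW_div_bounds c' j 7 hα hℓ hc hQ2a hQ2b ht1
    htP hΛ4
  have hd := ((h6d.hasDerivAt).div_const (0.504 : ℂ)).add
    ((h7d.hasDerivAt.const_mul iota2).div_const (0.5 : ℂ))
  have e504 : ‖(0.504 : ℂ)‖ = 0.504 := by norm_num
  have e5 : ‖(0.5 : ℂ)‖ = 0.5 := by norm_num
  have hi0 : 0 ≤ ‖iota2‖ := norm_nonneg _
  refine ⟨hd.differentiableAt, ?_, ?_⟩
  · calc ‖frakfW c' D j 6 (bigP D ^ (0.504 : ℝ) / t) / 0.504 +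
          iota2 * frakfW c' D j 7 (bigP D ^ (0.5 : ℝ) / t) / 0.5‖
        ≤ ‖frakfW c' D j 6 (bigP D ^ (0.504 : ℝ) / t) / 0.504‖ +
            ‖iota2 * frakfW c' D j 7 (bigP D ^ (0.5 : ℝ) / t) / 0.5‖ := norm_add_le _ _
      _ = ‖frakfW c' D j 6 (bigP D ^ (0.504 : ℝ) / t)‖ / 0.504 +
            ‖iota2‖ * ‖frakfW c' D j 7 (bigP D ^ (0.5 : ℝ) / t)‖ / 0.5 := by
          rw [norm_div, norm_div, norm_mul, e504, e5]
      _ ≤ 29 / 0.504 + ‖iota2‖ * 29 / 0.5 := by gcongr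
      _ ≤ 58 * (1 + ‖iota2‖) := by
          have h1 : (29 : ℝ) / 0.504 ≤ 58 := by norm_num
          have h2 : ‖iota2‖ * 29 / 0.5 = 58 * ‖iota2‖ := by ring
          rw [h2]; linarith
  · have hderiv : deriv (fun u : ℝ => frakfW c' D j 6 (bigP D ^ (0.504 : ℝ) / u) / 0.504 +
        iota2 * frakfW c' D j 7 (bigP D ^ (0.5 : ℝ) / u) / 0.5) t =
        deriv (fun u => frakfW c' D j 6 (bigP D ^ (0.504 : ℝ) / u)) t / 0.504 +
          iota2 * deriv (fun u => frakfW c' D j 7 (bigP D ^ (0.5 : ℝ) / u)) t / 0.5 := hd.deriv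
    rw [hderiv]
    calc ‖deriv (fun u => frakfW c' D j 6 (bigP D ^ (0.504 : ℝ) / u)) t / 0.504 +
          iota2 * deriv (fun u => frakfW c' D j 7 (bigP D ^ (0.5 : ℝ) / u)) t / 0.5‖
        ≤ ‖deriv (fun u => frakfW c' D j 6 (bigP D ^ (0.504 : ℝ) / u)) t / 0.504‖ +
            ‖iota2 * deriv (fun u => frakfW c' D j 7 (bigP D ^ (0.5 : ℝ) / u)) t / 0.5‖ :=
          norm_add_le _ _
      _ = ‖deriv (fun u => frakfW c' D j 6 (bigP D ^ (0.504 : ℝ) / u)) t‖ / 0.504 +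
            ‖iota2‖ * ‖deriv (fun u => frakfW c' D j 7 (bigP D ^ (0.5 : ℝ) / u)) t‖ / 0.5 := by
          rw [norm_div, norm_div, norm_mul, e504, e5]
      _ ≤ (94 * alpha D / t) / 0.504 + ‖iota2‖ * (94 * alpha D / t) / 0.5 := by gcongr
      _ = (94 / 0.504 + ‖iota2‖ * 188) * alpha D / t := by ring
      _ ≤ 188 * (1 + ‖iota2‖) * alpha D / t := by
          apply div_le_div_of_nonneg_right _ ht.le
          apply mul_le_mul_of_nonneg_right _ hα.le
          have h1 : (94 : ℝ) / 0.504 ≤ 188 := by norm_num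
          linarith

/-! ### Standing largeness -/

/-- The common largeness facts at a large modulus. [cite: Zhang2022LandauSiegel, §2 (2.6), (2.10)] -/
theorem basic_facts_of_ell_six {c' : ℝ} {D : ℕ} (hℓ6 : 6 ≤ ell D)
    (hc5 : |5 * c'| * alpha D * ell D ≤ 1) :
    0 < ell D ∧ 1 < bigP D ∧ 0 < Real.log (bigP D) ∧ 0 < alpha D ∧
      alpha D * ell D = π / ell D ^ 8 ∧ alpha D * Real.log (bigP D) ≤ 4 ∧
      5 * |c'| * alpha D * ell D ≤ 1 ∧ 1 ≤ bigP D ^ (0.5 : ℝ) := by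
  have hℓ0 : 0 < ell D := by linarith
  have hP1 : 1 < bigP D := by rw [bigP]; exact Real.one_lt_exp_iff.2 (pow_pos hℓ0 9)
  have hlogP : Real.log (bigP D) = ell D ^ 9 := by rw [bigP, Real.log_exp]
  have hΛ : 0 < Real.log (bigP D) := by rw [hlogP]; positivity
  have hα : 0 < alpha D := Sec10C.alpha_pos hΛ
  have hαℓ : alpha D * ell D = π / ell D ^ 8 := Sec10C.alpha_mul_ell hℓ0
  have hΛ4 : alpha D * Real.log (bigP D) ≤ 4 := by
    rw [alpha, div_mul_cancel₀ _ hΛ.ne']; linarith [Real.pi_lt_d2]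
  have hc : 5 * |c'| * alpha D * ell D ≤ 1 := by
    have : |5 * c'| = 5 * |c'| := by rw [abs_mul, abs_of_pos (by norm_num : (0:ℝ) < 5)]
    rw [this] at hc5; linarith [hc5]
  exact ⟨hℓ0, hP1, hΛ, hα, hαℓ, hΛ4, hc, Real.one_le_rpow hP1.le (by norm_num)⟩

end Profiles1113

end Literature.NumberTheory.LFunctions.Zhang2022.Typed.Sec10B
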